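import Literature.MathematicalPhysics.QuantumManyBody.PeriodizedPotentialHessianBound
import HarnessLib

/-!
# The density-wave Hessian of the periodic pair interaction: phase sum and Puff's bound

Topic `Literature/MathematicalPhysics/QuantumManyBody`; companion of
`PeriodizedPotentialHessianBound.lean`. For the periodic `N`-body pair interaction
`V(X) = ∑_{a<b} v^per(x_a - x_b)` (real-valued, `C²` for a `C²` pair function `ṽ(y) = v(|y|)` of
range `R₀ < L/2`, `PeriodizedPotentialNearestImage.lean`) and a mode `m` of the torus with wave
vector `k = 2πm/L`, write `∂ⱼ = k·∇_{xⱼ}` (the derivative along `Pi.single j k`) and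
`eⱼ = e^{ik·xⱼ}` (`cellWave L m (X j)`). We prove

* `fderiv_toReal_periodicInteraction_single`, `fderiv_fderiv_toReal_periodicInteraction_single`
  — the pair structure of the first two density-wave derivatives of `V`:
  `∂ⱼV = ∑_{a<b} (δ_{aj} - δ_{bj}) ∂_k v^per(x_{ab})`,
  `∂ₗ∂ⱼV = ∑_{a<b} (δ_{aj} - δ_{bj})(δ_{al} - δ_{bl}) ∂_k∂_k v^per(x_{ab})`;
* `sum_phase_mul_hessian_eq` — the **phase sum**
  `∑_{j,l} eⱼ ēₗ ∂ₗ∂ⱼV = ∑_{a<b} |e_a - e_b|² ∂_k∂_k v^per(x_{ab})` (a real number);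
* `re_sum_phase_mul_hessian_le` — **Puff's bound** on it by the periodic Puff pair weight:
  `Re ∑_{j,l} eⱼ ēₗ ∂ₗ∂ⱼV(X) ≤ ‖k‖⁴ ∑_{a<b} W^per(x_a - x_b)`, `W(r) = r²‖D²ṽ(r e₀)‖`
  (from `phase_sq_mul_hessian_le_puffWeight`, pair by pair).

This is the potential term of Puff's cubic energy-weighted moment of the density response
[Puff1965; Stringari1995, §2.3 (23)]. All `[folklore]` calculus except where cited.
-/

noncomputable section

open Filter Metric Topology
open scoped ENNReal NNReal ComplexConjugate

namespace Literature.MathematicalPhysics.QuantumManyBody.BoseGas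

variable {N : ℕ} {v : ℝ → ℝ≥0∞} {R₀ L : ℝ}

/-! ### The pair structure of the density-wave derivatives -/

section PairStructure

/-- Chain rule for a pair function: the derivative of `Y ↦ g(y_a - y_b)` along `w ∈ (ℝ³)^N` is
`Dg(x_a - x_b)·(w_a - w_b)`. [folklore] -/
theorem fderiv_comp_pair_apply {g : Space → ℝ} (hg : Differentiable ℝ g) (a b : Fin N)
    (X w : Config N) :
    fderiv ℝ (fun Y : Config N => g (Y a - Y b)) X w = fderiv ℝ g (X a - X b) (w a - w b) := by
  set ℓ : Config N →L[ℝ] Space :=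
    (ContinuousLinearMap.proj (R := ℝ) (φ := fun _ : Fin N => Space) a) -
      ContinuousLinearMap.proj (R := ℝ) (φ := fun _ : Fin N => Space) b with hℓ
  have hℓapp : ∀ Y : Config N, ℓ Y = Y a - Y b := fun Y => rfl
  have h : HasFDerivAt (fun Y : Config N => g (Y a - Y b)) ((fderiv ℝ g (X a - X b)).comp ℓ) X := by
    have h0 := (hg (ℓ X)).hasFDerivAt.comp X ℓ.hasFDerivAt
    exact h0
  rw [h.fderiv, ContinuousLinearMap.comp_apply, hℓapp]

/-- `Y ↦ g(y_a - y_b)` is differentiable for differentiable `g`. [folklore] -/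
theorem differentiable_comp_pair {g : Space → ℝ} (hg : Differentiable ℝ g) (a b : Fin N) :
    Differentiable ℝ (fun Y : Config N => g (Y a - Y b)) := by
  intro X
  set ℓ : Config N →L[ℝ] Space :=
    (ContinuousLinearMap.proj (R := ℝ) (φ := fun _ : Fin N => Space) a) -
      ContinuousLinearMap.proj (R := ℝ) (φ := fun _ : Fin N => Space) b with hℓ
  have h : HasFDerivAt (fun Y : Config N => g (Y a - Y b)) ((fderiv ℝ g (X a - X b)).comp ℓ) X := by
    have h0 := (hg (ℓ X)).hasFDerivAt.comp X ℓ.hasFDerivAt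
    exact h0
  exact h.differentiableAt

/-- The density-wave direction `Pi.single j k` seen by the pair `(a, b)`:
`(Pi.single j k)_a - (Pi.single j k)_b = (δ_{aj} - δ_{bj}) k`. [folklore] -/
theorem single_apply_sub_single_apply (j a b : Fin N) (k : Space) :
    (Pi.single j k : Config N) a - (Pi.single j k : Config N) b =
      ((if a = j then (1 : ℝ) else 0) - (if b = j then (1 : ℝ) else 0)) • k := by
  simp only [Pi.single_apply]
  split_ifs <;> simp

variable (hv : ∀ r, R₀ < r → v r = 0) (h2R : 2 * R₀ < L) (hL : 0 < L) (hfin : ∀ r, v r ≠ ⊤)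
  (hC : ContDiff ℝ 2 (fun x : Space => (v ‖x‖).toReal))
include hv h2R hL hfin hC

/-- **First density-wave derivative of the periodic interaction**:
`∂_{x_j·k} V(X) = ∑_{a<b} (δ_{aj} - δ_{bj}) ∂_k v^per(x_a - x_b)`. [folklore] -/
theorem fderiv_toReal_periodicInteraction_single (j : Fin N) (k : Space) (X : Config N) :
    fderiv ℝ (fun Y : Config N => (periodicInteraction v L Y).toReal) X (Pi.single j k) =
      ∑ a : Fin N, ∑ b : Fin N with a < b,
        ((if a = j then (1 : ℝ) else 0) - (if b = j then (1 : ℝ) else 0)) *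
          fderiv ℝ (fun y => (periodizedPotential v L y).toReal) (X a - X b) k := by
  have hp : ContDiff ℝ 2 (fun y => (periodizedPotential v L y).toReal) :=
    contDiff_toReal_periodizedPotential hv h2R hL hC
  have hpd := hp.differentiable two_ne_zero
  have hV : (fun Y : Config N => (periodicInteraction v L Y).toReal) = fun Y =>
      ∑ a : Fin N, ∑ b : Fin N with a < b, (periodizedPotential v L (Y a - Y b)).toReal :=
    funext fun Y => toReal_periodicInteraction_of_range hv h2R hL hfin Y
  rw [hV, fderiv_fun_sum fun a _ => ?_, FunLike.coe_sum, Finset.sum_apply]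
  · refine Finset.sum_congr rfl fun a _ => ?_
    rw [fderiv_fun_sum fun b _ => differentiable_comp_pair hpd a b X,
      FunLike.coe_sum, Finset.sum_apply]
    refine Finset.sum_congr rfl fun b _ => ?_
    rw [fderiv_comp_pair_apply hpd, single_apply_sub_single_apply, map_smul, smul_eq_mul]
  · exact (DifferentiableAt.fun_sum fun b _ => differentiable_comp_pair hpd a b X)

/-- **Second density-wave derivative of the periodic interaction**:
`∂_{x_l·k}∂_{x_j·k} V(X) = ∑_{a<b} (δ_{aj} - δ_{bj})(δ_{al} - δ_{bl}) ∂_k∂_k v^per(x_a - x_b)`.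
[folklore] -/
theorem fderiv_fderiv_toReal_periodicInteraction_single (j l : Fin N) (k : Space) (X : Config N) :
    fderiv ℝ (fun Y : Config N => fderiv ℝ (fun Z : Config N => (periodicInteraction v L Z).toReal) Y
        (Pi.single j k)) X (Pi.single l k) =
      ∑ a : Fin N, ∑ b : Fin N with a < b,
        ((if a = j then (1 : ℝ) else 0) - (if b = j then (1 : ℝ) else 0)) *
          (((if a = l then (1 : ℝ) else 0) - (if b = l then (1 : ℝ) else 0)) *
            fderiv ℝ (fun x => fderiv ℝ (fun y => (periodizedPotential v L y).toReal) x k)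
              (X a - X b) k) := by
  have hp : ContDiff ℝ 2 (fun y => (periodizedPotential v L y).toReal) :=
    contDiff_toReal_periodizedPotential hv h2R hL hC
  have hD1 : ContDiff ℝ 1 (fun x => fderiv ℝ (fun y => (periodizedPotential v L y).toReal) x k) :=
    (hp.fderiv_right (m := 1) (by norm_num)).clm_apply contDiff_const
  have hD1d := hD1.differentiable one_ne_zero
  have h1 : (fun Y : Config N => fderiv ℝ (fun Z : Config N => (periodicInteraction v L Z).toReal) Y
      (Pi.single j k)) = fun Y => ∑ a : Fin N, ∑ b : Fin N with a < b,
        ((if a = j then (1 : ℝ) else 0) - (if b = j then (1 : ℝ) else 0)) *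
          fderiv ℝ (fun y => (periodizedPotential v L y).toReal) (Y a - Y b) k :=
    funext fun Y => fderiv_toReal_periodicInteraction_single hv h2R hL hfin hC j k Y
  have hterm : ∀ a b : Fin N, DifferentiableAt ℝ (fun Y : Config N =>
      ((if a = j then (1 : ℝ) else 0) - (if b = j then (1 : ℝ) else 0)) *
        fderiv ℝ (fun y => (periodizedPotential v L y).toReal) (Y a - Y b) k) X :=
    fun a b => (differentiable_comp_pair hD1d a b X).const_mul _
  rw [h1, fderiv_fun_sum fun a _ => ?_, FunLike.coe_sum, Finset.sum_apply]
  · refine Finset.sum_congr rfl fun a _ => ?_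
    rw [fderiv_fun_sum fun b _ => hterm a b, FunLike.coe_sum, Finset.sum_apply]
    refine Finset.sum_congr rfl fun b _ => ?_
    rw [fderiv_const_mul (differentiable_comp_pair hD1d a b X)]
    simp only [FunLike.coe_smul, Pi.smul_apply, smul_eq_mul]
    rw [fderiv_comp_pair_apply hD1d, single_apply_sub_single_apply, map_smul, smul_eq_mul]
  · exact (DifferentiableAt.fun_sum fun b _ => hterm a b)

end PairStructure

/-! ### The phase sum -/

section PhaseSum

/-- `∑ⱼ (δ_{aj} - δ_{bj}) zⱼ = z_a - z_b`. [folklore] -/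
theorem sum_delta_sub_delta_mul (a b : Fin N) (z : Fin N → ℂ) :
    ∑ j : Fin N, ((((if a = j then (1 : ℝ) else 0) - (if b = j then (1 : ℝ) else 0)) : ℝ) : ℂ) *
      z j = z a - z b := by
  have h : ∀ j : Fin N, ((((if a = j then (1 : ℝ) else 0) - (if b = j then (1 : ℝ) else 0)) : ℝ) :
      ℂ) * z j = (if a = j then z j else 0) - (if b = j then z j else 0) := by
    intro j
    split_ifs <;> push_cast <;> ring
  simp_rw [h]
  rw [Finset.sum_sub_distrib, Finset.sum_ite_eq, Finset.sum_ite_eq, if_pos (Finset.mem_univ a),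
    if_pos (Finset.mem_univ b)]

/-- Exchange of a double sum with a double sum over a dependent range. [folklore] -/
private theorem sum_comm₄ {α β γ δ M : Type*} [AddCommMonoid M] (s : Finset α) (t : Finset β)
    (u : Finset γ) (w : γ → Finset δ) (f : α → β → γ → δ → M) :
    ∑ a ∈ s, ∑ b ∈ t, ∑ c ∈ u, ∑ d ∈ w c, f a b c d =
      ∑ c ∈ u, ∑ d ∈ w c, ∑ a ∈ s, ∑ b ∈ t, f a b c d := by
  calc ∑ a ∈ s, ∑ b ∈ t, ∑ c ∈ u, ∑ d ∈ w c, f a b c d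
      = ∑ a ∈ s, ∑ c ∈ u, ∑ b ∈ t, ∑ d ∈ w c, f a b c d :=
        Finset.sum_congr rfl fun a _ => Finset.sum_comm
    _ = ∑ c ∈ u, ∑ a ∈ s, ∑ b ∈ t, ∑ d ∈ w c, f a b c d := Finset.sum_comm
    _ = ∑ c ∈ u, ∑ a ∈ s, ∑ d ∈ w c, ∑ b ∈ t, f a b c d :=
        Finset.sum_congr rfl fun c _ => Finset.sum_congr rfl fun a _ => Finset.sum_comm
    _ = ∑ c ∈ u, ∑ d ∈ w c, ∑ a ∈ s, ∑ b ∈ t, f a b c d :=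
        Finset.sum_congr rfl fun c _ => Finset.sum_comm

/-- **The phase sum.** For real pair coefficients `H_{ab}`,
`∑_{j,l} eⱼ ēₗ ∑_{a<b} (δ_{aj}-δ_{bj})(δ_{al}-δ_{bl}) H_{ab} = ∑_{a<b} |e_a - e_b|² H_{ab}`.
[folklore] -/
theorem sum_phase_mul_pairCoeff_eq (e : Fin N → ℂ) (H : Fin N → Fin N → ℝ) :
    ∑ j : Fin N, ∑ l : Fin N, e j * conj (e l) *
        ((∑ a : Fin N, ∑ b : Fin N with a < b,
          ((if a = j then (1 : ℝ) else 0) - (if b = j then (1 : ℝ) else 0)) *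
            (((if a = l then (1 : ℝ) else 0) - (if b = l then (1 : ℝ) else 0)) * H a b) : ℝ) :
              ℂ) =
      ((∑ a : Fin N, ∑ b : Fin N with a < b, ‖e a - e b‖ ^ 2 * H a b : ℝ) : ℂ) := by
  -- the coefficients as complex numbers
  set c : Fin N → Fin N → Fin N → ℂ := fun j a b =>
    ((((if a = j then (1 : ℝ) else 0) - (if b = j then (1 : ℝ) else 0)) : ℝ) : ℂ) with hc
  -- expand
  have hswap : ∀ j l : Fin N, e j * conj (e l) *
      ((∑ a : Fin N, ∑ b : Fin N with a < b,
        ((if a = j then (1 : ℝ) else 0) - (if b = j then (1 : ℝ) else 0)) *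
          (((if a = l then (1 : ℝ) else 0) - (if b = l then (1 : ℝ) else 0)) * H a b) : ℝ) :
            ℂ) =
      ∑ a : Fin N, ∑ b : Fin N with a < b,
        (c j a b * e j) * (c l a b * conj (e l)) * ((H a b : ℝ) : ℂ) := by
    intro j l
    rw [Complex.ofReal_sum, Finset.mul_sum]
    refine Finset.sum_congr rfl fun a _ => ?_
    rw [Complex.ofReal_sum, Finset.mul_sum]
    refine Finset.sum_congr rfl fun b _ => ?_
    simp only [hc]
    push_cast
    ring
  simp_rw [hswap]
  rw [sum_comm₄, Complex.ofReal_sum]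
  refine Finset.sum_congr rfl fun a _ => ?_
  rw [Complex.ofReal_sum]
  refine Finset.sum_congr rfl fun b _ => ?_
  -- factor the double sum over `j, l`
  have hfac : ∑ j : Fin N, ∑ l : Fin N, (c j a b * e j) * (c l a b * conj (e l)) * ((H a b : ℝ) : ℂ) =
      (∑ j : Fin N, c j a b * e j) * (∑ l : Fin N, c l a b * conj (e l)) * ((H a b : ℝ) : ℂ) := by
    rw [Finset.sum_mul, Finset.sum_mul]
    refine Finset.sum_congr rfl fun j _ => ?_
    rw [Finset.mul_sum, Finset.sum_mul]
  have h1 : ∑ j : Fin N, c j a b * e j = e a - e b := sum_delta_sub_delta_mul a b e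
  have h2 : ∑ l : Fin N, c l a b * conj (e l) = conj (e a - e b) := by
    rw [map_sub]
    exact sum_delta_sub_delta_mul a b (fun l => conj (e l))
  rw [hfac, h1, h2, Complex.mul_conj, Complex.normSq_eq_norm_sq]
  push_cast
  ring

end PhaseSum

/-! ### Puff's bound on the phase-weighted Hessian of the interaction -/

section Bound

/-- `e_m(x) = e_m(x - y) e_m(y)`, hence `|e_m(x) - e_m(y)| = |e_m(x - y) - 1|`. [folklore] -/
theorem norm_cellWave_sub_cellWave (L : ℝ) (m : Fin 3 → ℤ) (x y : Space) :
    ‖cellWave L m x - cellWave L m y‖ = ‖cellWave L m (x - y) - 1‖ := by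
  have hmul : cellWave L m x = cellWave L m (x - y) * cellWave L m y := by
    rw [cellWave_apply, cellWave_apply, cellWave_apply, ← Complex.exp_add]
    congr 1
    simp only [PiLp.sub_apply, mul_sub, Finset.sum_sub_distrib]
    push_cast
    ring
  rw [hmul, ← sub_one_mul, norm_mul, norm_cellWave, mul_one]

variable (hv : ∀ r, R₀ < r → v r = 0) (h2R : 2 * R₀ < L) (hL : 0 < L) (hfin : ∀ r, v r ≠ ⊤)
  (hC : ContDiff ℝ 2 (fun x : Space => (v ‖x‖).toReal))
include hv h2R hL hfin hC

/-- **Puff's bound on the density-wave Hessian of the periodic interaction.** With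
`V = ∑_{a<b} v^per(x_a - x_b)` (real, `C²`), `k = 2πm/L`, `∂ⱼ = k·∇_{xⱼ}` and `eⱼ = e^{ik·xⱼ}`:
`Re ∑_{j,l} eⱼ ēₗ ∂ₗ∂ⱼV(X) ≤ ‖k‖⁴ · ∑_{a<b} W^per(x_a - x_b)` for every configuration `X`, where
`W(r) = r²‖D²ṽ(r e₀)‖` is the Puff pair weight (the left side equals
`∑_{a<b} |e_a - e_b|² ∂_k∂_k v^per(x_{ab})`, and each pair is estimated by
`phase_sq_mul_hessian_le_puffWeight`). [cite: Stringari1995, §2.3 (23)] -/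
theorem re_sum_phase_mul_hessian_le (m : Fin 3 → ℤ) (X : Config N) :
    (∑ j : Fin N, ∑ l : Fin N, cellWave L m (X j) * conj (cellWave L m (X l)) *
        ((fderiv ℝ (fun Y : Config N => fderiv ℝ
            (fun Z : Config N => (periodicInteraction v L Z).toReal) Y
            (Pi.single j ((2 * Real.pi / L) • latticeVec 1 m))) X
          (Pi.single l ((2 * Real.pi / L) • latticeVec 1 m)) : ℝ) : ℂ)).re ≤
      ‖(2 * Real.pi / L) • latticeVec 1 m‖ ^ 4 *
        (periodicInteraction (fun r : ℝ => ENNReal.ofReal (r ^ 2 *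
          ‖iteratedFDeriv ℝ 2 (fun x : Space => (v ‖x‖).toReal)
            (r • EuclideanSpace.single (0 : Fin 3) (1 : ℝ))‖)) L X).toReal := by
  set k : Space := (2 * Real.pi / L) • latticeVec 1 m with hk
  set W : ℝ → ℝ≥0∞ := fun r : ℝ => ENNReal.ofReal (r ^ 2 *
    ‖iteratedFDeriv ℝ 2 (fun x : Space => (v ‖x‖).toReal)
      (r • EuclideanSpace.single (0 : Fin 3) (1 : ℝ))‖) with hW
  set Hf : Space → ℝ := fun y =>
    fderiv ℝ (fun x => fderiv ℝ (fun z => (periodizedPotential v L z).toReal) x k) y k with hHf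
  simp_rw [fderiv_fderiv_toReal_periodicInteraction_single hv h2R hL hfin hC]
  rw [sum_phase_mul_pairCoeff_eq (fun j => cellWave L m (X j)) (fun a b => Hf (X a - X b)),
    Complex.ofReal_re]
  -- the weight is an admissible finite-range profile
  have hWR : ∀ r, R₀ < r → W r = 0 := fun r hr => puffWeight_eq_zero_of_lt hv hr
  rw [toReal_periodicInteraction_of_range hWR h2R hL (fun r => ENNReal.ofReal_ne_top) X,
    Finset.mul_sum]
  refine Finset.sum_le_sum fun a _ => ?_
  rw [Finset.mul_sum]
  refine Finset.sum_le_sum fun b _ => ?_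
  calc ‖cellWave L m (X a) - cellWave L m (X b)‖ ^ 2 * Hf (X a - X b)
      ≤ ‖cellWave L m (X a) - cellWave L m (X b)‖ ^ 2 * |Hf (X a - X b)| :=
        mul_le_mul_of_nonneg_left (le_abs_self _) (sq_nonneg _)
    _ = ‖cellWave L m (X a - X b) - 1‖ ^ 2 * |Hf (X a - X b)| := by
        rw [norm_cellWave_sub_cellWave]
    _ ≤ ‖k‖ ^ 4 * (periodizedPotential W L (X a - X b)).toReal :=
        phase_sq_mul_hessian_le_puffWeight hv h2R hL hC m (X a - X b)

end Bound

end Literature.MathematicalPhysics.QuantumManyBody.BoseGas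

end
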